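import Summits.BirchSwinnertonDyer.BirchSwinnertonDyer.Theorems.EisensteinPrimesB11L3Door
import Literature.NumberTheory.EllipticCurves.PAdicLFunctionSplitRiemannSumCertificateProofs
import Literature.NumberTheory.EllipticCurves.PlusSymbolBoundOddMultiplicativeProofs
import HarnessLib

/-!
# Row B11 (crux 4 `BSDpOnCellC`, stmt-BirchSwinnertonDyer-19034) — lever L3, §4: the READING of the
# certificate is ONE EXACT RIEMANN SUM (doors taking `p⁻ⁿ < ‖RS_{1+e}(n)‖` and the valuation identity ON
# THE RIEMANN SUM instead of on `[T^(1+e)]L`)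

Cell `bsd-eis` (HOME `run/shared/lean/pub/bsd-eis/`), seat `bsd-eis-k5-p3` gen 3 (prover). The L3 doors of
record (`EisensteinPrimesB11L3Door.lean`: §1/§2 p534013 order reading, §3 p545218 coefficient reading) take
as per-pair input a statement about THE Mazur–Tate–Teitelbaum function `L` of the pair: `[T^(1+e)]L ≠ 0`
and `v_p(ϖ·[T^(1+e)]L·log_p(γ)^(1+e)·#tors²) = v_p(A·Reg_p)` (`A = 𝓛_p·∏c` split, `2·∏c` non-split).
What the lane's L-side engines (B = exact modular symbols cc3_mstw ‖ cc3_msadd; C = AFE; E = eclib)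
actually COMPUTE is a finite object: the Riemann sum `RS k n = Σ_s C(s,k)·μ_{n+1}(ξ·γ^s)` of the plus
modular symbols of the newform at level `n + 1` (the `T^k`-coefficient of the Mazur–Tate element), and
the booked tables (B11-L3CW v1 / ADD-1 / ADD-2, referee B R836/R849) apply the rule «the read of
`v_p([T^(1+e)]L)` is EXACT iff `v_p(RS_{1+e}(n)) < n`». THIS FILE puts that rule in the kernel for the L3
road: by the Literature theorems `IsSplitMultPAdicLFunctionOf.norm_coeff_eq_of_split_of_lt` /
`IsMultPAdicLFunctionOf.norm_coeff_eq_of_nonsplit_of_lt` (truncation error `≤ C·p⁻ⁿ/‖k!‖`, ultrametric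
equality; [MazurTateTeitelbaum1986Invent] §I.11–I.14) and the symbol bound `C = 1` at an odd
multiplicative prime in positive analytic rank
(`IsNewformOf.norm_ratPlusSymbol_val_div_le_one_of_multiplicative_of_analyticRank_ne_zero`, no hypothesis
on `E[p]`, the image or the Manin constant), ONE level `n` with `p⁻ⁿ < ‖RS_{1+e}(n)‖` gives
`‖[T^(1+e)]L‖ = ‖RS_{1+e}(n)‖` and `[T^(1+e)]L ≠ 0` for every `L` of the package, so the §3 doors apply
with the valuation identity transported from `RS_{1+e}(n)` to `[T^(1+e)]L`.

WHAT IS PROVED (theorems only; `--supports` the item as a helper, closes nothing):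
* `valuation_eq_of_norm_eq`, `valuation_mul₃_congr` — bookkeeping: equal norms of non-zero `p`-adic
  numbers give equal valuations, also inside a product `a·x·c` (any `a`, `c`).
* `bsdp_of_cellC_of_split_of_thm16_of_l3RiemannSumCertificate` — X2c, SPLIT `p ‖ N`: `CellC W p`, the
  class-level PUB binders of §1 (`hWu` Wuthrich 2014 Thm. 16, `hJs` Stein–Wuthrich 2013 Thm. 6.1 split,
  `hGZ`, `hGZK`, `hpar`), `hsha` (`p ∤ #Ш_an`) and the per-pair READ `hcert`: for THE newform `f`, the
  period ratio `ϖ`, the Riemann sums `RS` of `[·]⁺_f` (shape `hRS` of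
  `PAdicLFunctionSplitRiemannSumCertificateProofs`), THE Tate datum and THE §4.2 height: SOME level `n`
  with `p⁻ⁿ/‖2‖_p < ‖RS 2 n‖` and `v_p(ϖ·RS 2 n·log_p(γ)²·#tors²) = v_p(𝓛_p·∏c·Reg_p)` ⟹ `BSDp W p`.
* `bsdp_of_cellC_of_not_split_of_thm16_of_l3RiemannSumCertificate` — X2c, NON-split `p ‖ N`: the same
  with the signed measure `(−1)ⁿ[a/pⁿ]⁺_f` (shape `hRS` of `PAdicLFunctionNonsplitRiemannSumCertificateProofs`),
  `k = 1`, `p⁻ⁿ < ‖RS 1 n‖`, identity `v_p(ϖ·RS 1 n·log_p(γ)·#tors²) = v_p(2·∏c·Reg_p)`.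

HONEST FRAMING: per-pair CONDITIONAL theorems; the Riemann-sum inequality and the identity are READ by
two engines per cell and enter as hypotheses; nothing about any particular curve is asserted; nothing is
booked by this file; X2c stays CONSTRUCTION-SHAPED as a class; BSD is proved for no curve unconditionally.

References: [MazurTateTeitelbaum1986Invent] §I.10 Prop., §I.11, §I.14 (14.3); [SteinWuthrich2013] §3,
§4.2, Thm. 6.1 (p. 20); [Wuthrich2014] Thm. 16 (p. 397); [Miller2011LMS] Def. 1.1, Prop. 7.6;
HOME/k5-p3-g2/README.md §2 («EXACT iff v_p(b_(1+e)) < m − 1»).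
-/

set_option linter.dupNamespace false
set_option autoImplicit false

noncomputable section

open scoped Classical MatrixGroups ModularForm

open WeierstrassCurve PowerSeries CongruenceSubgroup
  Literature.NumberTheory.EllipticCurves
  Literature.NumberTheory.EllipticCurves.ModularForms
  Literature.NumberTheory.EllipticCurves.Rank1Residual
  Literature.NumberTheory.EllipticCurves.Rank1Residual.Typed
  Literature.NumberTheory.EllipticCurves.Wuthrich2014
  Literature.NumberTheory.EllipticCurves.SteinWuthrich2013
  Literature.NumberTheory.EllipticCurves.Disegni2020
  Summit.BirchSwinnertonDyer.Rank1Residual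
  Summit.BirchSwinnertonDyer.Rank1Residual.X2

namespace Summit.BirchSwinnertonDyer.BirchSwinnertonDyer.Theorems.B11L3

/-! ## §4.0 Bookkeeping: equal norms ⟹ equal valuations -/

/-- Two NON-ZERO `p`-adic numbers with the same norm have the same valuation (`‖x‖ = p^(−v(x))`). -/
theorem valuation_eq_of_norm_eq {p : ℕ} [Fact p.Prime] {x y : ℚ_[p]} (hx : x ≠ 0) (hy : y ≠ 0)
    (h : ‖x‖ = ‖y‖) : x.valuation = y.valuation := by
  have hp_pos : (0 : ℝ) < p := by exact_mod_cast (Fact.out : p.Prime).pos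
  have hp_ne_one : (p : ℝ) ≠ 1 := by exact_mod_cast (Fact.out : p.Prime).ne_one
  rw [Padic.norm_eq_zpow_neg_valuation hx, Padic.norm_eq_zpow_neg_valuation hy,
    zpow_right_inj₀ hp_pos hp_ne_one, neg_inj] at h
  exact h

/-- Inside a product: `‖x‖ = ‖y‖` with `x, y ≠ 0` gives `v(a·x·c) = v(a·y·c)` (both sides are
`v(0)` when `a = 0` or `c = 0`). -/
theorem valuation_mul₃_congr {p : ℕ} [Fact p.Prime] {a x y c : ℚ_[p]} (hx : x ≠ 0) (hy : y ≠ 0)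
    (h : ‖x‖ = ‖y‖) : (a * x * c).valuation = (a * y * c).valuation := by
  by_cases ha : a = 0
  · simp only [ha, zero_mul]
  by_cases hc : c = 0
  · simp only [hc, mul_zero]
  refine valuation_eq_of_norm_eq (mul_ne_zero (mul_ne_zero ha hx) hc)
    (mul_ne_zero (mul_ne_zero ha hy) hc) ?_
  simp only [norm_mul, h]

variable (W : WeierstrassCurve ℚ) [W.IsElliptic] [W.IsGloballyMinimal] (p : ℕ) [Fact p.Prime]

/-! ## §4.1 Split multiplicative `p`: the L3 certificate READ as one Riemann sum `RS 2 n` -/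

/-- **X2c, SPLIT `p ‖ N` — §3 with the RIEMANN-SUM reading.** `hcert` asks, for THE newform `f` of `W`
(any `IsNewformOf W f`), the period ratio `ϖ` (`ϖ·Ω_W = Ω⁺_f`), the Riemann sums `RS` of the plus
symbols `[a/pⁿ]⁺_f` (the shape `hRS` of `PAdicLFunctionSplitRiemannSumCertificateProofs`: `RS k n` = the
`T^k`-coefficient of the level-`(n+1)` Mazur–Tate element), THE Tate datum `Dq` and THE §4.2 split height
`Dh`: ONE level `n` with `p⁻ⁿ/‖2!‖_p < ‖RS 2 n‖` (the «EXACT» rule of the booked L3CW tables) and the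
identity `v_p(ϖ·RS 2 n·log_p(γ_cyc)²·#tors²) = v_p(𝓛_p·∏c_v·Reg_p)`. Inside: the plus symbols are
`p`-integral (`C = 1`, odd multiplicative `p`, analytic rank `≠ 0`), so `‖[T²]L‖ = ‖RS 2 n‖` and
`[T²]L ≠ 0` for THE split function `L` (`IsSplitMultPAdicLFunctionOf.norm_coeff_eq_of_split_of_lt`), and
§3 `bsdp_of_cellC_of_split_of_thm16_of_l3CoeffCertificate` applies. [cite: MazurTateTeitelbaum1986Invent, §I.11 and §I.14 (14.3)]
[cite: Wuthrich2014, Thm. 16 (p. 397)] [cite: SteinWuthrich2013, Thm. 6.1 (p. 20), §3 and §4.2]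
[cite: Miller2011LMS, Def. 1.1 and Prop. 7.6] -/
theorem bsdp_of_cellC_of_split_of_thm16_of_l3RiemannSumCertificate
    (hWu : thm16_charIdeal_dvd_multiplicative_of_reducible) (hJs : thm61_splitMultiplicative)
    (hGZ : GrossZagier1986_thm_I_7_3) (hGZK : rank_eq_analyticRank_of_analyticRank_le_one)
    (hpar : nonempty_modularParametrizationData)
    (hc : CellC W p) (hsplit : W.HasSplitMultiplicativeReductionAtPrime p)
    (hcert : ∀ {N : ℕ} [NeZero N] (f : CuspForm (Gamma0 N) 2), IsNewformOf W f →
      ∀ (ϖ : ℚ), (ϖ : ℝ) * W.realPeriodRat = plusPeriod f →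
      ∀ (RS : ℕ → ℕ → ℚ_[p]), (∀ k n : ℕ, RS k n =
        ∑ᶠ ξ : rootsOfUnity (torsionOrder p) ℤ_[p], ∑ s : ZMod (p ^ n),
          (fun (n : ℕ) (a : ZMod (p ^ n)) ↦ (ratPlusSymbol f ((a.val : ℚ) / (p : ℚ) ^ n) : ℚ_[p]))
            (n + cyclotomicExponent p)
              (PadicInt.toZModPow (n + cyclotomicExponent p) ((ξ : ℤ_[p]ˣ) : ℤ_[p]) *
                (cyclotomicGenerator p : ZMod (p ^ (n + cyclotomicExponent p))) ^ s.val) *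
            ((s.val.choose k : ℕ) : ℚ_[p])) →
      ∀ (Dq : TateParameterData W p) (Dh : PAdicHeightData W p), IsSplitMultCanonical Dh Dq →
        ∃ n : ℕ, 1 / ‖((Nat.factorial 2 : ℕ) : ℚ_[p])‖ * (p : ℝ) ^ (-n : ℤ) < ‖RS 2 n‖ ∧
        (((ϖ : ℚ) : ℚ_[p]) * RS 2 n *
            (padicLog p (cyclotomicGenerator p) ^ 2 * (W.torsionOrder : ℚ_[p]) ^ 2)).valuation =
          (LInvariant Dq * (W.tamagawaProduct : ℚ_[p]) * padicRegulator Dh).valuation)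
    (hsha : ∀ s : ℚ, shaAn W = (s : ℂ) → padicValRat p s = 0) :
    BSDp W p := by
  have hr1 : W.analyticRank = 1 := hc.1
  have hp2 : p ≠ 2 := hc.2.1
  refine bsdp_of_cellC_of_split_of_thm16_of_l3CoeffCertificate W p hWu hJs hGZ hGZK hpar hc hsplit
    ?_ hsha
  intro N _ f hf ϖ hϖ L hL Dq Dh hDh
  -- the Riemann sums of `[·]⁺_f`, by definition
  set RS : ℕ → ℕ → ℚ_[p] := fun k n ↦
    ∑ᶠ ξ : rootsOfUnity (torsionOrder p) ℤ_[p], ∑ s : ZMod (p ^ n),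
      (fun (n : ℕ) (a : ZMod (p ^ n)) ↦ (ratPlusSymbol f ((a.val : ℚ) / (p : ℚ) ^ n) : ℚ_[p]))
        (n + cyclotomicExponent p)
          (PadicInt.toZModPow (n + cyclotomicExponent p) ((ξ : ℤ_[p]ˣ) : ℤ_[p]) *
            (cyclotomicGenerator p : ZMod (p ^ (n + cyclotomicExponent p))) ^ s.val) *
        ((s.val.choose k : ℕ) : ℚ_[p]) with hRSdef
  have hRS : ∀ k n : ℕ, RS k n = _ := fun k n ↦ by rw [hRSdef]
  obtain ⟨n, hlt, hval⟩ := hcert f hf ϖ hϖ RS hRS Dq Dh hDh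
  -- plus symbols are `p`-integral at an odd multiplicative prime in positive analytic rank: `C = 1`
  have hC : ∀ (m : ℕ) (a : ZMod (p ^ m)),
      ‖(ratPlusSymbol f ((a.val : ℚ) / (p : ℚ) ^ m) : ℚ_[p])‖ ≤ 1 := fun m a ↦
    hf.norm_ratPlusSymbol_val_div_le_one_of_multiplicative_of_analyticRank_ne_zero hp2
      hsplit.hasMultiplicativeReductionAtPrime (by rw [hr1]; exact one_ne_zero) m a
  obtain ⟨hnorm, hcoeff⟩ := hL.norm_coeff_eq_of_split_of_lt hRS hsplit hf hC (k := 2) (n := n) hlt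
  refine ⟨hcoeff, ?_⟩
  -- transport the valuation identity from `RS 2 n` to `[T²]L`
  have hRS0 : RS 2 n ≠ 0 := by
    intro h0
    rw [h0, norm_zero] at hnorm
    exact hcoeff (norm_eq_zero.mp hnorm)
  rw [← hval]
  exact valuation_mul₃_congr hcoeff hRS0 hnorm

/-! ## §4.2 Non-split multiplicative `p`: the L3 certificate READ as one Riemann sum `RS 1 n` -/

/-- **X2c, NON-split `p ‖ N` — §3 with the RIEMANN-SUM reading.** `hcert` asks, for THE newform `f`,
`ϖ`, the Riemann sums `RS` of the SIGNED measure `(−1)ⁿ[a/pⁿ]⁺_f` (shape `hRS` of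
`PAdicLFunctionNonsplitRiemannSumCertificateProofs`), THE Tate parameter `q` and THE §4.2 height `Dh`:
ONE level `n` with `p⁻ⁿ/‖1!‖_p < ‖RS 1 n‖` and `v_p(ϖ·RS 1 n·log_p(γ_cyc)·#tors²) = v_p(2·∏c_v·Reg_p)`.
Inside: `C = 1`, `‖[T¹]L‖ = ‖RS 1 n‖`, `[T¹]L ≠ 0` (`IsMultPAdicLFunctionOf.norm_coeff_eq_of_nonsplit_of_lt`),
then §3 `bsdp_of_cellC_of_not_split_of_thm16_of_l3CoeffCertificate`.
[cite: MazurTateTeitelbaum1986Invent, §I.11 and §I.14 (14.3)] [cite: Wuthrich2014, Thm. 16 (p. 397)]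
[cite: SteinWuthrich2013, Thm. 6.1 (p. 20), §3.1 (p. 9), §3 and §4.2] [cite: Miller2011LMS, Def. 1.1 and Prop. 7.6] -/
theorem bsdp_of_cellC_of_not_split_of_thm16_of_l3RiemannSumCertificate
    (hWu : thm16_charIdeal_dvd_multiplicative_of_reducible) (hJn : thm61_nonsplitMultiplicative)
    (hGZ : GrossZagier1986_thm_I_7_3) (hGZK : rank_eq_analyticRank_of_analyticRank_le_one)
    (hpar : nonempty_modularParametrizationData)
    (hc : CellC W p) (hns : ¬ W.HasSplitMultiplicativeReductionAtPrime p)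
    (hcert : ∀ {N : ℕ} [NeZero N] (f : CuspForm (Gamma0 N) 2), IsNewformOf W f →
      ∀ (ϖ : ℚ), (ϖ : ℝ) * W.realPeriodRat = plusPeriod f →
      ∀ (RS : ℕ → ℕ → ℚ_[p]), (∀ k n : ℕ, RS k n =
        ∑ᶠ ξ : rootsOfUnity (torsionOrder p) ℤ_[p], ∑ s : ZMod (p ^ n),
          (fun (n : ℕ) (a : ZMod (p ^ n)) ↦
              (-1 : ℚ_[p]) ^ n * (ratPlusSymbol f ((a.val : ℚ) / (p : ℚ) ^ n) : ℚ_[p]))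
            (n + cyclotomicExponent p)
              (PadicInt.toZModPow (n + cyclotomicExponent p) ((ξ : ℤ_[p]ˣ) : ℤ_[p]) *
                (cyclotomicGenerator p : ZMod (p ^ (n + cyclotomicExponent p))) ^ s.val) *
            ((s.val.choose k : ℕ) : ℚ_[p])) →
      ∀ (q : ℚ_[p]), q ≠ 0 → ‖q‖ < 1 → tateJ q = (W.j : ℚ_[p]) →
      ∀ (Dh : PAdicHeightData W p), IsMultCanonical Dh q →
        ∃ n : ℕ, 1 / ‖((Nat.factorial 1 : ℕ) : ℚ_[p])‖ * (p : ℝ) ^ (-n : ℤ) < ‖RS 1 n‖ ∧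
        (((ϖ : ℚ) : ℚ_[p]) * RS 1 n *
            (padicLog p (cyclotomicGenerator p) ^ 1 * (W.torsionOrder : ℚ_[p]) ^ 2)).valuation =
          (2 * (W.tamagawaProduct : ℚ_[p]) * padicRegulator Dh).valuation)
    (hsha : ∀ s : ℚ, shaAn W = (s : ℂ) → padicValRat p s = 0) :
    BSDp W p := by
  have hr1 : W.analyticRank = 1 := hc.1
  have hp2 : p ≠ 2 := hc.2.1
  have hmult : W.HasMultiplicativeReductionAtPrime p := hc.2.2.2
  refine bsdp_of_cellC_of_not_split_of_thm16_of_l3CoeffCertificate W p hWu hJn hGZ hGZK hpar hc hns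
    ?_ hsha
  intro N _ f hf ϖ hϖ L hL q hq0 hq1 hqj Dh hDh
  set RS : ℕ → ℕ → ℚ_[p] := fun k n ↦
    ∑ᶠ ξ : rootsOfUnity (torsionOrder p) ℤ_[p], ∑ s : ZMod (p ^ n),
      (fun (n : ℕ) (a : ZMod (p ^ n)) ↦
          (-1 : ℚ_[p]) ^ n * (ratPlusSymbol f ((a.val : ℚ) / (p : ℚ) ^ n) : ℚ_[p]))
        (n + cyclotomicExponent p)
          (PadicInt.toZModPow (n + cyclotomicExponent p) ((ξ : ℤ_[p]ˣ) : ℤ_[p]) *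
            (cyclotomicGenerator p : ZMod (p ^ (n + cyclotomicExponent p))) ^ s.val) *
        ((s.val.choose k : ℕ) : ℚ_[p]) with hRSdef
  have hRS : ∀ k n : ℕ, RS k n = _ := fun k n ↦ by rw [hRSdef]
  obtain ⟨n, hlt, hval⟩ := hcert f hf ϖ hϖ RS hRS q hq0 hq1 hqj Dh hDh
  have hC : ∀ (m : ℕ) (a : ZMod (p ^ m)),
      ‖(ratPlusSymbol f ((a.val : ℚ) / (p : ℚ) ^ m) : ℚ_[p])‖ ≤ 1 := fun m a ↦
    hf.norm_ratPlusSymbol_val_div_le_one_of_multiplicative_of_analyticRank_ne_zero hp2 hmult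
      (by rw [hr1]; exact one_ne_zero) m a
  obtain ⟨hnorm, hcoeff⟩ := hL.norm_coeff_eq_of_nonsplit_of_lt hRS hf hmult hns hC (k := 1) (n := n) hlt
  refine ⟨hcoeff, ?_⟩
  have hRS0 : RS 1 n ≠ 0 := by
    intro h0
    rw [h0, norm_zero] at hnorm
    exact hcoeff (norm_eq_zero.mp hnorm)
  rw [← hval]
  exact valuation_mul₃_congr hcoeff hRS0 hnorm

end Summit.BirchSwinnertonDyer.BirchSwinnertonDyer.Theorems.B11L3

end
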